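import Literature.NumberTheory.GaloisRepresentations.ArtinConductorIntegrality
import Literature.NumberTheory.GaloisRepresentations.RamificationFiltrationHerbrandProofs
import Literature.NumberTheory.GaloisRepresentations.RamificationFiltrationTowerProofs
import HarnessLib

/-!
# Integrality of the Artin conductor: the lower-numbering formula on inertia, proved
(trunk GalRep, item C10, companion to `ArtinConductorIntegrality.lean`)

D-0014 keeps `Literature/` sorry-free by stating cited results as named facts `def X : Prop`.
This sibling file proves the named fact
`Literature.NumberTheory.GaloisRepresentations.GaloisRep.artinConductorAt_eq_artinExponent_inertia` of `ArtinConductorIntegrality.lean`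
(**`a_𝔓(ρ) = f(ρ|_{I_𝔓})`**: the Artin conductor `codim M^{I_𝔓} + ∫₀^∞ codim M^{Γ_K^u} du` of a
Galois representation inflated on inertia from a finite level `Gal(E/K)` is Serre's lower-numbering
sum `Σ_{i ≥ 0} (g_i/g_0) codim M^{G_i}`) from the single remaining input, Herbrand's theorem for
`K̄/E/K` in the form `Γ_K^u|_E = Gal(E/K)^u` (the named fact
`Literature.NumberTheory.GaloisRepresentations.absUpperRamificationSubgroup_map_absRestrictNormalHom`, threaded as the hypothesis `hH`):

* `Literature.GaloisRep.artinConductorAt_eq_artinExponent_inertia_of hH`;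
* `Literature.absUpperRamificationSubgroup_map_absRestrictNormalHom_of hq` — the hypothesis `hH` itself
  (Herbrand's theorem for `K̄/E/K`) from the parent's finite-level fact `herbrand_quotient` for
  all layers of `K̄` (`RamificationFiltrationTowerProofs.lean`: transport of structure and
  compactness of `Γ_K`), so that finally
  `Literature.GaloisRep.exists_natCast_eq_artinConductorAt_of_hasOpenInertiaKerAt_of_herbrand_quotient hq hint`:
  **the corrected Artin–Katz integrality statement follows from `herbrand_quotient` (Serre IV §3
  Prop. 14) and Artin's theorem for the inertia group (Serre VI §2 Thm 1') alone**;
* hence (composing with the reductions proved in `ArtinConductorIntegrality.lean`)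
  `Literature.GaloisRep.artinConductorAt_eq_finsum_ramificationSubgroup_of_herbrand hH` (the parent file's
  `artinConductorAt_eq_finsum_ramificationSubgroup`) and
  `Literature.GaloisRep.exists_natCast_eq_artinConductorAt_of_hasOpenInertiaKerAt_of_herbrand hH hint`:
  **the corrected Artin–Katz integrality statement follows from Herbrand's theorem for `K̄/E/K`
  and Artin's theorem for the inertia group** (`Literature.NumberTheory.GaloisRepresentations.exists_natCast_eq_artinExponent`, hypothesis
  `hint`), the two inputs that remain named facts.

Auxiliary results proved here:
* the **Herbrand calculus** of a finite group (Serre, *Local Fields*, Ch. IV §3; file-private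
  helpers, the corresponding named facts of `RamificationFiltration.lean` being discharged in their
  own sibling files): `φ` is strictly increasing (slopes `≥ 1/#G_0`) and surjective (continuous by
  `Literature.NumberTheory.GaloisRepresentations.continuous_herbrandPhi_holds` of `RamificationFiltrationHerbrandProofs.lean`, unbounded in
  both directions), hence an order isomorphism of `ℝ` with inverse `ψ` (`φ (ψ v) = v`,
  `ψ (φ u) = u`, `ψ` monotone); the localisation `⌈ψ u⌉ = i` on `(φ(i-1), φ(i)]`; and, public,
  the values at integers `Literature.NumberTheory.GaloisRepresentations.herbrandPhi_natCast` (`φ(n) = Σ_{i=1}^{n} #G_i/#G_0`, Serre: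
  "`φ(m) + 1 = g_0⁻¹(g_0 + ⋯ + g_m)`") and **the upper-numbering integral of a step function**
  `Literature.NumberTheory.GaloisRepresentations.integral_Ioi_comp_ceil_herbrandPsi`: for `c` vanishing beyond `N`,
  `∫₀^∞ c(⌈ψ u⌉) du = Σ_{i=1}^{N} (#G_i/#G_0) c(i)`, the change of variables between Katz's
  `Swan = ∫₀^∞ codim M^{G^u} du` and Serre's `Σ_{i ≥ 1} (g_i/g_0) codim M^{G_i}`;
* `Literature.NumberTheory.GaloisRepresentations.faithfulSMul_algEquiv_integralClosure` (`Gal(L/K)` acts faithfully on the integral closure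
  of `R` in `L`, `K = Frac R`), `Literature.NumberTheory.GaloisRepresentations.ramificationSubgroup_comap_eventually_eq_bot`
  (`G_i(𝔓 ∩ E) = 1` for `i ≫ 0`), `Literature.NumberTheory.GaloisRepresentations.GaloisRep.fixedSubmodule_absUpperRamificationSubgroup_eq`
  (`M^{Γ_K^u} = M^{\{σ ∈ I_𝔓 : σ|_E ∈ Gal(E/K)^u\}}`).

## Proof (Katz, proof of Prop. 1.9: "the compatibility between upper and lower numbering")

Let `ρ` be trivial on `Gal(K̄/E) ∩ I_𝔓`, `π : σ ↦ σ|_E`, `G_i`, `G^u` the ramification groups of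
`G = Gal(E/K)` at `𝔓_E = 𝔓 ∩ E`, and `c_i = codim M^{\{σ ∈ I_𝔓 : π σ ∈ G_i\}}`.
(1) `M^{Γ_K^u} = M^{\{σ ∈ I_𝔓 : π σ ∈ G^u\}}`: `⊇` as `Γ_K^u ≤ I_𝔓` restricts into `G^u`; `⊆` because
every `σ ∈ I_𝔓` with `π σ ∈ G^u = π(Γ_K^u)` (hypothesis `hH`) is `γ n` with `γ ∈ Γ_K^u` and
`n ∈ Gal(K̄/E) ∩ I_𝔓`, on which `ρ` is trivial.  Since `G^u = G_{⌈ψ u⌉}` this makes the integrand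
of `sw_𝔓(ρ)` equal to `c_{⌈ψ u⌉}` on `(0, ∞)`.
(2) `G_i = 1` for `i > N` (`Ideal.ramificationSubgroup_eventually_eq_bot` for the Noetherian domain
`integralClosure (𝓞 K) E` with its faithful `Gal(E/K)`-action), and then `c_i = 0` (`ρ` is trivial
on `Gal(K̄/E) ∩ I_𝔓`).
(3) `∫₀^∞ c_{⌈ψ u⌉} du = Σ_{i=1}^{N} (g_i/g_0) c_i` (`Literature.NumberTheory.GaloisRepresentations.integral_Ioi_comp_ceil_herbrandPsi`:
`φ(i) - φ(i-1) = g_i/g_0`).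
(4) `codim M^{I_𝔓} = c_0` since `π(I_𝔓) ≤ G_0` (`Literature.NumberTheory.GaloisRepresentations.inertia_map_absRestrictNormalHom_le`).
Summing, `a_𝔓(ρ) = Σ_{i=0}^{N} (g_i/g_0) c_i = f(ρ|_{I_𝔓})`.

## References

* N. M. Katz, *Gauss Sums, Kloosterman Sums, and Monodromy Groups* (1988), Ch. 1, 1.1, 1.6, proof
  of Prop. 1.9. [Katz1988]
* J.-P. Serre, *Local Fields* (1979), Ch. IV §1 Prop. 1, §3 (the functions `φ`, `ψ`, Props. 12–14,
  Remark 1); Ch. VI §2, Cor. 1' to Prop. 2, Exercise 1. [SerreLocalFields1979]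
-/

noncomputable section

open scoped NumberField
open Field IsDedekindDomain MeasureTheory Module Set Filter

namespace Literature.NumberTheory.GaloisRepresentations

universe u v w

/-! ### The Herbrand calculus of a finite group -/

section HerbrandCalculus

variable {S : Type*} [CommRing S] (𝔓 : Ideal S) (G : Type*) [Group G] [MulSemiringAction G S]

/-- `(b - a)/#G_0 ≤ φ(b) - φ(a)` for `a ≤ b` (the slopes of `φ` are `≥ 1/#G_0`).
Ref: Serre, *Local Fields*, Ch. IV §3, Prop. 12. [folklore] -/
private theorem div_card_le_herbrandPhi_sub [Finite G] {a b : ℝ} (hab : a ≤ b) :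
    (b - a) / Nat.card (𝔓.ramificationSubgroup G 0) ≤ herbrandPhi 𝔓 G b - herbrandPhi 𝔓 G a := by
  rw [herbrandPhi_sub_herbrandPhi, div_eq_mul_inv, ← smul_eq_mul, ← intervalIntegral.integral_const]
  exact intervalIntegral.integral_mono_on hab intervalIntegrable_const
    (herbrandIntegrand_intervalIntegrable 𝔓 G a b) fun t _ => inv_card_le_herbrandIntegrand 𝔓 G t

/-- `φ(u) → +∞` as `u → +∞` (`φ(u) ≥ u/#G_0` for `u ≥ 0`).
Ref: Serre, *Local Fields*, Ch. IV §3 (`φ` is a homeomorphism of `[-1, ∞)`). [folklore] -/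
private theorem herbrandPhi_tendsto_atTop [Finite G] : Tendsto (herbrandPhi 𝔓 G) atTop atTop := by
  refine tendsto_atTop_mono' atTop ?_
    (tendsto_id.atTop_div_const
      (Nat.cast_pos.mpr (Nat.card_pos (α := 𝔓.ramificationSubgroup G 0))))
  filter_upwards [eventually_ge_atTop 0] with u hu
  have h := div_card_le_herbrandPhi_sub 𝔓 G hu
  rw [herbrandPhi_zero, sub_zero, sub_zero] at h
  exact h

/-- `φ(u) → -∞` as `u → -∞` (`φ(u) = u` for `u ≤ 0`).
Ref: Serre, *Local Fields*, Ch. IV §3. [folklore] -/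
private theorem herbrandPhi_tendsto_atBot [Finite G] : Tendsto (herbrandPhi 𝔓 G) atBot atBot := by
  refine tendsto_atBot_mono' atBot ?_ tendsto_id
  filter_upwards [eventually_le_atBot 0] with u hu
  rw [herbrandPhi_of_nonpos 𝔓 hu]
  exact le_rfl

/-- `φ : ℝ → ℝ` is surjective (continuous, unbounded in both directions).
Ref: Serre, *Local Fields*, Ch. IV §3 ("the function `φ` is a homeomorphism … its inverse `ψ`").
[folklore] -/
private theorem herbrandPhi_surjective [Finite G] : Function.Surjective (herbrandPhi 𝔓 G) :=
  (continuous_herbrandPhi_holds 𝔓 G).surjective (herbrandPhi_tendsto_atTop 𝔓 G)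
    (herbrandPhi_tendsto_atBot 𝔓 G)

/-- `ψ = φ⁻¹`: `ψ(v)` is the value at `v` of the inverse of the order isomorphism `φ` of `ℝ`
(Mathlib `StrictMono.orderIsoOfSurjective`); indeed `{u | φ u ≤ v} = (-∞, φ⁻¹ v]`.
Ref: Serre, *Local Fields*, Ch. IV §3, before Prop. 13 ("the inverse function `ψ`"). [folklore] -/
private theorem herbrandPsi_eq_orderIso_symm [Finite G] (v : ℝ) :
    herbrandPsi 𝔓 G v = (StrictMono.orderIsoOfSurjective _ (herbrandPhi_strictMono 𝔓 G)
      (Literature.NumberTheory.GaloisRepresentations.herbrandPhi_surjective 𝔓 G)).symm v := by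
  set e := StrictMono.orderIsoOfSurjective _ (herbrandPhi_strictMono 𝔓 G)
    (Literature.NumberTheory.GaloisRepresentations.herbrandPhi_surjective 𝔓 G)
  rw [herbrandPsi]
  have : {u : ℝ | herbrandPhi 𝔓 G u ≤ v} = Iic (e.symm v) := by
    ext u
    rw [mem_setOf_eq, mem_Iic, OrderIso.le_symm_apply]
    exact Iff.rfl
  rw [this, csSup_Iic]

/-- `φ (ψ v) = v` for finite `G` (the content of the parent's fact `herbrandPhi_herbrandPsi`).
Ref: Serre, *Local Fields*, Ch. IV §3 (`ψ = φ⁻¹`, before Prop. 13). [folklore] -/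
private theorem herbrandPhi_apply_herbrandPsi [Finite G] (v : ℝ) :
    herbrandPhi 𝔓 G (herbrandPsi 𝔓 G v) = v := by
  rw [herbrandPsi_eq_orderIso_symm]
  exact (StrictMono.orderIsoOfSurjective _ (herbrandPhi_strictMono 𝔓 G)
    (Literature.NumberTheory.GaloisRepresentations.herbrandPhi_surjective 𝔓 G)).apply_symm_apply v

/-- `ψ (φ u) = u` for finite `G` (the content of the parent's fact `herbrandPsi_herbrandPhi`).
Ref: Serre, *Local Fields*, Ch. IV §3 (`ψ = φ⁻¹`, before Prop. 13). [folklore] -/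
private theorem herbrandPsi_apply_herbrandPhi [Finite G] (u : ℝ) :
    herbrandPsi 𝔓 G (herbrandPhi 𝔓 G u) = u := by
  rw [herbrandPsi_eq_orderIso_symm]
  exact (StrictMono.orderIsoOfSurjective _ (herbrandPhi_strictMono 𝔓 G)
    (Literature.NumberTheory.GaloisRepresentations.herbrandPhi_surjective 𝔓 G)).symm_apply_apply u

/-- `ψ` is monotone for finite `G` (the content of the parent's fact `herbrandPsi_monotone`).
Ref: Serre, *Local Fields*, Ch. IV §3, before Prop. 13. [folklore] -/
private theorem herbrandPsi_mono [Finite G] : Monotone (herbrandPsi 𝔓 G) := by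
  intro v w hvw
  rw [herbrandPsi_eq_orderIso_symm, herbrandPsi_eq_orderIso_symm]
  exact (StrictMono.orderIsoOfSurjective _ (herbrandPhi_strictMono 𝔓 G)
    (Literature.NumberTheory.GaloisRepresentations.herbrandPhi_surjective 𝔓 G)).symm.monotone hvw

/-- `ψ` is strictly increasing (finite `G`).  Ref: Serre, *Local Fields*, Ch. IV §3. [folklore] -/
private theorem herbrandPsi_strictMono [Finite G] : StrictMono (herbrandPsi 𝔓 G) := by
  intro v w hvw
  rw [herbrandPsi_eq_orderIso_symm, herbrandPsi_eq_orderIso_symm]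
  exact (StrictMono.orderIsoOfSurjective _ (herbrandPhi_strictMono 𝔓 G)
    (Literature.NumberTheory.GaloisRepresentations.herbrandPhi_surjective 𝔓 G)).symm.strictMono hvw

/-- On `(n, n+1]` the Herbrand integrand is the constant `#G_{n+1}/#G_0`.
Ref: Serre, *Local Fields*, Ch. IV §3 (`φ` is linear of slope `1/(G_0 : G_{m+1})` on `[m, m+1]`).
[folklore] -/
private theorem herbrandIntegrand_of_mem_Ioc {n : ℕ} {t : ℝ} (ht : t ∈ Ioc (n : ℝ) (n + 1)) :
    herbrandIntegrand 𝔓 G t =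
      (Nat.card (𝔓.ramificationSubgroup G (n + 1)) : ℝ) / Nat.card (𝔓.ramificationSubgroup G 0) := by
  rw [herbrandIntegrand, inv_div]
  have : ⌈t⌉₊ = n + 1 := by
    rw [Nat.ceil_eq_iff (Nat.succ_ne_zero n), Nat.succ_sub_one]
    exact ⟨ht.1, by exact_mod_cast ht.2⟩
  rw [this]

/-- `φ(n+1) - φ(n) = #G_{n+1}/#G_0` (finite `G`).
Ref: Serre, *Local Fields*, Ch. IV §3 ("`φ(m) + 1 = g_0⁻¹(g_0 + g_1 + ⋯ + g_m)`"). [folklore] -/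
private theorem herbrandPhi_succ_sub [Finite G] (n : ℕ) :
    herbrandPhi 𝔓 G (n + 1) - herbrandPhi 𝔓 G n =
      (Nat.card (𝔓.ramificationSubgroup G (n + 1)) : ℝ) / Nat.card (𝔓.ramificationSubgroup G 0) := by
  rw [herbrandPhi_sub_herbrandPhi, intervalIntegral.integral_of_le (by linarith),
    setIntegral_congr_fun measurableSet_Ioc (fun t ht => herbrandIntegrand_of_mem_Ioc 𝔓 G ht),
    setIntegral_const, Real.volume_real_Ioc]
  simp

/-- **Values of `φ` at integers**: `φ(n) = Σ_{i<n} #G_{i+1}/#G_0 = (g_1 + ⋯ + g_n)/g_0` (finite `G`).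
Ref: Serre, *Local Fields*, Ch. IV §3, before Prop. 12 ("`φ(m) + 1 = g_0⁻¹ Σ_{i=0}^{m} g_i`").
[cite: SerreLocalFields1979, Ch. IV §3 (before Prop. 12)] -/
theorem herbrandPhi_natCast [Finite G] (n : ℕ) :
    herbrandPhi 𝔓 G n = ∑ i ∈ Finset.range n,
      (Nat.card (𝔓.ramificationSubgroup G (i + 1)) : ℝ) / Nat.card (𝔓.ramificationSubgroup G 0) := by
  induction n with
  | zero => simp
  | succ n ih =>
    rw [Finset.sum_range_succ, ← ih, ← herbrandPhi_succ_sub 𝔓 G n]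
    push_cast
    ring

/-- `φ(n) ≥ 0` for `n : ℕ` (finite `G`).  Ref: Serre, *Local Fields*, Ch. IV §3. [folklore] -/
private theorem herbrandPhi_natCast_nonneg [Finite G] (n : ℕ) : 0 ≤ herbrandPhi 𝔓 G n := by
  have := (herbrandPhi_strictMono 𝔓 G).monotone (Nat.cast_nonneg n : (0 : ℝ) ≤ n)
  rwa [herbrandPhi_zero] at this

/-- **Localisation of `⌈ψ u⌉`**: for `u ∈ (φ(i-1), φ(i)]`, `i ≥ 1`, one has `⌈ψ(u)⌉₊ = i`, i.e.
`G^u = G_i` there.  Ref: Serre, *Local Fields*, Ch. IV §3 (`G^{φ(u)} = G_u`, `G_u = G_i` for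
`i - 1 < u ≤ i`). [folklore] -/
private theorem ceil_herbrandPsi_eq [Finite G] {i : ℕ} (hi : i ≠ 0) {u : ℝ}
    (hu : u ∈ Ioc (herbrandPhi 𝔓 G ((i - 1 : ℕ) : ℝ)) (herbrandPhi 𝔓 G i)) :
    ⌈herbrandPsi 𝔓 G u⌉₊ = i := by
  rw [Nat.ceil_eq_iff hi]
  have h1 := Literature.NumberTheory.GaloisRepresentations.herbrandPsi_strictMono 𝔓 G hu.1
  have h2 := herbrandPsi_mono 𝔓 G hu.2
  rw [herbrandPsi_apply_herbrandPhi] at h1 h2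
  exact ⟨h1, h2⟩

/-- For `u > 0`, `i := ⌈ψ(u)⌉₊` is `≥ 1` and `u ∈ (φ(i-1), φ(i)]`.
Ref: Serre, *Local Fields*, Ch. IV §3. [folklore] -/
private theorem mem_Ioc_herbrandPhi_ceil_herbrandPsi [Finite G] {u : ℝ} (hu : 0 < u) :
    ⌈herbrandPsi 𝔓 G u⌉₊ ≠ 0 ∧
      u ∈ Ioc (herbrandPhi 𝔓 G ((⌈herbrandPsi 𝔓 G u⌉₊ - 1 : ℕ) : ℝ))
        (herbrandPhi 𝔓 G (⌈herbrandPsi 𝔓 G u⌉₊ : ℕ)) := by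
  have hpos : 0 < herbrandPsi 𝔓 G u := by
    have := Literature.NumberTheory.GaloisRepresentations.herbrandPsi_strictMono 𝔓 G (show herbrandPhi 𝔓 G 0 < u by rwa [herbrandPhi_zero])
    rwa [herbrandPsi_apply_herbrandPhi] at this
  have hi : ⌈herbrandPsi 𝔓 G u⌉₊ ≠ 0 := Nat.pos_iff_ne_zero.mp (Nat.ceil_pos.mpr hpos)
  refine ⟨hi, ?_, ?_⟩
  · have h := ((Nat.ceil_eq_iff hi).mp rfl).1
    have := herbrandPhi_strictMono 𝔓 G h
    rwa [herbrandPhi_apply_herbrandPsi] at this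
  · have h := Nat.le_ceil (herbrandPsi 𝔓 G u)
    have := (herbrandPhi_strictMono 𝔓 G).monotone h
    rwa [herbrandPhi_apply_herbrandPsi] at this

/-- **The upper-numbering integral of a step function.**  For finite `G` and a sequence
`c : ℕ → ℝ` vanishing beyond `N`, `∫₀^∞ c(⌈ψ u⌉₊) du = Σ_{i<N} (#G_{i+1}/#G_0) · c(i+1)`:
on `(φ(i), φ(i+1)]` the integrand is `c(i+1)` and `φ(i+1) - φ(i) = #G_{i+1}/#G_0`.  This is the
change of variables `∫₀^∞ codim M^{G^u} du = Σ_{i ≥ 1} (g_i/g_0) codim M^{G_i}` between Katz's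
`Swan(M)` in the upper numbering and Serre's lower-numbering sum.
Ref: Serre, *Local Fields*, Ch. VI §2, Cor. 1' to Prop. 2 and Exercise 1; Katz, *Gauss sums,
Kloosterman sums, and monodromy groups* (1988), Ch. 1, 1.6 and proof of Prop. 1.9. [folklore] -/
theorem integral_Ioi_comp_ceil_herbrandPsi [Finite G] (c : ℕ → ℝ) {N : ℕ}
    (hc : ∀ i, N < i → c i = 0) :
    ∫ u in Ioi (0 : ℝ), c ⌈herbrandPsi 𝔓 G u⌉₊ =
      ∑ i ∈ Finset.range N, (Nat.card (𝔓.ramificationSubgroup G (i + 1)) : ℝ) /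
        Nat.card (𝔓.ramificationSubgroup G 0) * c (i + 1) := by
  -- the step function
  set F : ℝ → ℝ := fun u => ∑ i ∈ Finset.range N,
    (Ioc (herbrandPhi 𝔓 G (i : ℝ)) (herbrandPhi 𝔓 G ((i + 1 : ℕ) : ℝ))).indicator
      (fun _ => c (i + 1)) u with hF
  have hmono := herbrandPhi_strictMono 𝔓 G
  -- pointwise identification on `ℝ`
  have hind : (Ioi (0 : ℝ)).indicator (fun u => c ⌈herbrandPsi 𝔓 G u⌉₊) = F := by
    funext u
    by_cases hu : 0 < u
    · rw [indicator_of_mem (mem_Ioi.mpr hu), hF]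
      obtain ⟨hj, hmem⟩ := mem_Ioc_herbrandPhi_ceil_herbrandPsi 𝔓 G hu
      set j := ⌈herbrandPsi 𝔓 G u⌉₊ with hjdef
      -- membership in the `i`-th interval iff `i + 1 = j`
      have key : ∀ i : ℕ, u ∈ Ioc (herbrandPhi 𝔓 G (i : ℝ)) (herbrandPhi 𝔓 G ((i + 1 : ℕ) : ℝ)) ↔
          i + 1 = j := by
        intro i
        constructor
        · intro hi
          have h1 : (i : ℝ) < j := by
            by_contra h
            push Not at h
            have : herbrandPhi 𝔓 G (j : ℝ) ≤ herbrandPhi 𝔓 G (i : ℝ) := hmono.monotone h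
            linarith [hi.1, hmem.2]
          have h2 : ((j - 1 : ℕ) : ℝ) < (i + 1 : ℕ) := by
            by_contra h
            push Not at h
            have : herbrandPhi 𝔓 G ((i + 1 : ℕ) : ℝ) ≤ herbrandPhi 𝔓 G ((j - 1 : ℕ) : ℝ) :=
              hmono.monotone h
            linarith [hi.2, hmem.1]
          have h1' : i < j := by exact_mod_cast h1
          have h2' : j - 1 < i + 1 := by exact_mod_cast h2
          omega
        · intro hij
          have hi' : i = j - 1 := by omega
          subst hi'
          rw [Nat.sub_add_cancel (Nat.pos_of_ne_zero hj)]
          exact hmem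
      simp only
      by_cases hjN : j ≤ N
      · rw [Finset.sum_eq_single (j - 1)]
        · have hj1 : j - 1 + 1 = j := Nat.sub_add_cancel (Nat.pos_of_ne_zero hj)
          rw [indicator_of_mem ((key _).mpr hj1), hj1]
        · intro i _ hi
          rw [indicator_of_notMem]
          intro hmem'
          exact hi (by have := (key i).mp hmem'; omega)
        · intro h
          exfalso
          exact h (Finset.mem_range.mpr (by omega))
      · push Not at hjN
        rw [hc j hjN]
        refine (Finset.sum_eq_zero fun i hi => ?_).symm
        rw [indicator_of_notMem]
        intro hmem'
        have := (key i).mp hmem'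
        have := Finset.mem_range.mp hi
        omega
    · rw [indicator_of_notMem (fun h => hu (mem_Ioi.mp h)), hF]
      simp only
      refine (Finset.sum_eq_zero fun i _ => ?_).symm
      rw [indicator_of_notMem]
      intro hmem'
      exact hu (lt_of_le_of_lt (herbrandPhi_natCast_nonneg 𝔓 G i) hmem'.1)
  -- integrate
  rw [← MeasureTheory.integral_indicator measurableSet_Ioi, hind, hF]
  simp only
  rw [MeasureTheory.integral_finsetSum]
  · refine Finset.sum_congr rfl fun i _ => ?_
    rw [MeasureTheory.integral_indicator measurableSet_Ioc, setIntegral_const, Real.volume_real_Ioc,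
      max_eq_left (sub_nonneg.mpr (hmono.monotone (by exact_mod_cast (Nat.le_succ i)))),
      smul_eq_mul]
    push_cast
    rw [herbrandPhi_succ_sub]
  · intro i _
    exact (integrableOn_const (measure_Ioc_lt_top).ne).integrable_indicator measurableSet_Ioc

end HerbrandCalculus


/-! ### Faithfulness and eventual triviality at the finite level -/

section Finite

/-- A `K`-automorphism of an algebraic extension `L/K`, `K = Frac R`, is determined by its action
on the integral closure of `R` in `L` (every element of `L` has a non-zero `R`-multiple which is
integral, Mathlib `IsAlgebraic.exists_integral_multiple`).
Ref: Serre, *Local Fields*, Ch. I §4 (`L = K ⊗ B`). [folklore] -/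
theorem faithfulSMul_algEquiv_integralClosure (R : Type*) {K L : Type*} [CommRing R] [IsDomain R]
    [Field K] [Field L] [Algebra R K] [IsFractionRing R K] [Algebra K L] [Algebra R L]
    [IsScalarTower R K L] [Algebra.IsAlgebraic K L] :
    FaithfulSMul (L ≃ₐ[K] L) (integralClosure R L) := by
  refine ⟨fun {σ τ} h => AlgEquiv.ext fun y => ?_⟩
  have halg : Algebra.IsAlgebraic R L := by
    have := IsLocalization.isAlgebraic K (nonZeroDivisors R)
    exact Algebra.IsAlgebraic.trans R K L
  obtain ⟨d, hd, hint⟩ := (halg.isAlgebraic y).exists_integral_multiple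
  have hx : σ (d • y) = τ (d • y) := congrArg Subtype.val (h ⟨d • y, hint⟩)
  rw [← algebraMap_smul K d y, map_smul, map_smul] at hx
  have hk : algebraMap R K d ≠ 0 := fun h0 =>
    hd ((IsFractionRing.injective R K) (by rw [h0, map_zero]))
  exact smul_right_injective L hk hx

/-- For a finite subextension `E/K` of `K̄/K` (`K = Frac R`, `R` an integrally closed Noetherian
domain, `E/K` separable) and a prime `𝔓` of `\bar ℤ_K = absIntegers R K`, the ramification groups
of `Gal(E/K)` at `𝔓 ∩ E` are eventually trivial: `Ideal.ramificationSubgroup_eventually_eq_bot`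
for the Noetherian domain `integralClosure R E` (Mathlib `IsIntegralClosure.isNoetherianRing`) with
its faithful `Gal(E/K)`-action (`faithfulSMul_algEquiv_integralClosure`).
Ref: Serre, *Local Fields*, Ch. IV §1, Prop. 1 ("`G_i = {1}` for `i` sufficiently large").
[cite: SerreLocalFields1979, Ch. IV §1 Prop. 1] -/
theorem ramificationSubgroup_comap_eventually_eq_bot (R : Type*) {K : Type*} [CommRing R]
    [IsDomain R] [IsIntegrallyClosed R] [IsNoetherianRing R] [Field K] [Algebra R K]
    [IsFractionRing R K] (𝔓 : Ideal (absIntegers R K)) [𝔓.IsPrime]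
    (E : IntermediateField K (AlgebraicClosure K)) [FiniteDimensional K E]
    [Algebra.IsSeparable K E] :
    ∃ N : ℕ, ∀ i, N ≤ i →
      (𝔓.comap (E.integralClosureToAbsIntegers R)).ramificationSubgroup (E ≃ₐ[K] E) i = ⊥ := by
  haveI : IsNoetherianRing (integralClosure R E) :=
    IsIntegralClosure.isNoetherianRing R K E (integralClosure R E)
  haveI : FaithfulSMul (E ≃ₐ[K] E) (integralClosure R E) := faithfulSMul_algEquiv_integralClosure R
  haveI : (𝔓.comap (E.integralClosureToAbsIntegers R)).IsPrime := Ideal.comap_isPrime _ _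
  exact Ideal.ramificationSubgroup_eventually_eq_bot_holds _ _ Ideal.IsPrime.ne_top'

end Finite

namespace GaloisRep

section Glue

variable {K : Type u} [Field K] {A : Type v} [Field A] [TopologicalSpace A]
  {M : Type w} [AddCommGroup M] [Module A M] [TopologicalSpace M]

/-- `{σ ∈ I_𝔓 : σ|_E ∈ I(𝔓 ∩ E)}` is all of `I_𝔓`: inertia restricts into inertia
(`inertia_map_absRestrictNormalHom_le`).
Ref: Serre, *Local Fields*, Ch. I §7, Prop. 22. [folklore] -/
theorem comap_inertia_comp_subtype_eq_top {R : Type*} [CommRing R] [Algebra R K]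
    (𝔓 : Ideal (absIntegers R K)) (E : IntermediateField K (AlgebraicClosure K)) [Normal K E] :
    ((𝔓.comap (E.integralClosureToAbsIntegers R)).inertia (E ≃ₐ[K] E)).comap
        ((absRestrictNormalHom E).comp (𝔓.inertia (absoluteGaloisGroup K)).subtype) = ⊤ := by
  rw [eq_top_iff]
  intro σ _
  rw [Subgroup.mem_comap, MonoidHom.comp_apply, Subgroup.subtype_apply]
  exact inertia_map_absRestrictNormalHom_le 𝔓 E ⟨σ, σ.2, rfl⟩

/-- **`M^{Γ_K^u} = M^{\{σ ∈ I_𝔓 : σ|_E ∈ Gal(E/K)^u\}}`** for `ρ` trivial on `Gal(K̄/E) ∩ I_𝔓`: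
`⊇` because `Γ_K^u ≤ I_𝔓` (`absUpperRamificationSubgroup_le_inertia_holds`) restricts into
`Gal(E/K)^u` (definition of `Γ_K^u`); `⊆` because, by Herbrand's theorem for `K̄/E/K`
(`absUpperRamificationSubgroup_map_absRestrictNormalHom`, hypothesis `hH`), every `σ ∈ I_𝔓` with
`σ|_E ∈ Gal(E/K)^u` is `γ · n` with `γ ∈ Γ_K^u` and `n ∈ Gal(K̄/E) ∩ I_𝔓`.
Ref: Serre, *Local Fields*, Ch. IV §3, Prop. 14 and Remark 1; Katz (1988), Ch. 1, proof of
Prop. 1.9. [cite: SerreLocalFields1979, Ch. IV §3 Prop. 14 and Remark 1] -/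
theorem fixedSubmodule_absUpperRamificationSubgroup_eq
    (hH : absUpperRamificationSubgroup_map_absRestrictNormalHom (K := K)) [NumberField K]
    {v : HeightOneSpectrum (𝓞 K)} {𝔓 : Ideal (absIntegers (𝓞 K) K)} (h𝔓 : 𝔓 ∈ v.primesAbove)
    (E : IntermediateField K (AlgebraicClosure K)) [FiniteDimensional K E] [Normal K E]
    (ρ : GaloisRep K A M)
    (hE : ∀ σ ∈ 𝔓.inertia (absoluteGaloisGroup K), absRestrictNormalHom E σ = 1 → ρ σ = 1)
    (u : ℝ) :
    ρ.fixedSubmodule (absUpperRamificationSubgroup (𝓞 K) 𝔓 u) =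
      Representation.fixedSubmodule
        (ρ.toRepresentation.comp (𝔓.inertia (absoluteGaloisGroup K)).subtype)
        ((upperRamificationSubgroup (𝔓.comap (E.integralClosureToAbsIntegers (𝓞 K))) (E ≃ₐ[K] E)
          u).comap ((absRestrictNormalHom E).comp (𝔓.inertia (absoluteGaloisGroup K)).subtype)) := by
  have hle := absUpperRamificationSubgroup_le_inertia_holds (𝓞 K) 𝔓 u (K := K)
  ext x
  rw [ContinuousRep.mem_fixedSubmodule, Representation.mem_fixedSubmodule]
  refine ⟨fun hx σ hσ => ?_, fun hx γ hγ => ?_⟩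
  · rw [Subgroup.mem_comap, MonoidHom.comp_apply, Subgroup.subtype_apply, ← hH h𝔓 E u] at hσ
    obtain ⟨γ, hγ, hγσ⟩ := hσ
    have hn : ρ (γ⁻¹ * σ) = 1 := by
      refine hE _ (Subgroup.mul_mem _ (Subgroup.inv_mem _ (hle hγ)) σ.2) ?_
      rw [map_mul, map_inv, hγσ, inv_mul_cancel]
    change ρ (σ : absoluteGaloisGroup K) x = x
    have h1 : ρ (σ : absoluteGaloisGroup K) = ρ γ := by
      conv_lhs => rw [← mul_inv_cancel_left γ (σ : absoluteGaloisGroup K), map_mul, hn, mul_one]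
    rw [h1]
    exact hx γ hγ
  · have hγu : absRestrictNormalHom E γ ∈
        upperRamificationSubgroup (𝔓.comap (E.integralClosureToAbsIntegers (𝓞 K))) (E ≃ₐ[K] E) u :=
      (mem_absUpperRamificationSubgroup_iff.mp hγ) E
    exact hx ⟨γ, hle hγ⟩ (Subgroup.mem_comap.mpr hγu)

/-- **Discharge of `Literature.NumberTheory.GaloisRepresentations.GaloisRep.artinConductorAt_eq_artinExponent_inertia` modulo Herbrand's
theorem for `K̄/E/K`.**  For `ρ` trivial on `Gal(K̄/E) ∩ I_𝔓`,
`a_𝔓(ρ) = codim M^{I_𝔓} + ∫₀^∞ codim M^{Γ_K^u} du = Σ_{i ≥ 0} (g_i/g_0) codim M^{\{σ ∈ I_𝔓 : σ|_E ∈ G_i\}}`: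
the integrand is `c_{⌈ψ u⌉}` on `(0, ∞)` (`fixedSubmodule_absUpperRamificationSubgroup_eq`,
`G^u = G_{⌈ψ u⌉}`), the `c_i` vanish for `i ≫ 0` (`ramificationSubgroup_comap_eventually_eq_bot`),
the integral is `Σ_{i ≥ 1} (g_i/g_0) c_i` (`integral_Ioi_comp_ceil_herbrandPsi`), and the tame term
is `c_0` (`comap_inertia_comp_subtype_eq_top`).  The hypothesis `hH` is the named fact
`absUpperRamificationSubgroup_map_absRestrictNormalHom` (D-0014).
Ref: Katz (1988), Ch. 1, proof of Prop. 1.9 ("the compatibility between upper and lower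
numbering"); Serre, *Local Fields*, Ch. VI §2, Cor. 1' to Prop. 2 and Exercise 1; Ch. IV §3,
Prop. 14 and Remark 1.
[cite: Katz1988, Ch. 1, Prop. 1.9 (proof)] [cite: SerreLocalFields1979, Ch. VI §2 Cor. 1' to Prop. 2] -/
theorem artinConductorAt_eq_artinExponent_inertia_of
    (hH : absUpperRamificationSubgroup_map_absRestrictNormalHom (K := K)) :
    artinConductorAt_eq_artinExponent_inertia (K := K) (A := A) (M := M) := by
  intro _ v 𝔓 h𝔓 E _ _ ρ hE
  classical
  haveI : 𝔓.IsPrime := (HeightOneSpectrum.isMaximal_of_mem_primesAbove h𝔓).isPrime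
  -- Step 0: `G_i = 1` for `i ≥ N`
  haveI : Algebra.IsSeparable K E := Algebra.IsSeparable.of_integral K E
  obtain ⟨N, hN⟩ := ramificationSubgroup_comap_eventually_eq_bot (𝓞 K) 𝔓 E
  -- notation
  set 𝔓E := 𝔓.comap (E.integralClosureToAbsIntegers (𝓞 K)) with h𝔓E
  set I := 𝔓.inertia (absoluteGaloisGroup K) with hI
  set j : I →* (E ≃ₐ[K] E) := (absRestrictNormalHom E).comp I.subtype with hj
  set τ : Representation A I M := ρ.toRepresentation.comp I.subtype with hτ
  -- the coefficients `c i = codim M^{j⁻¹ G_i}`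
  set c : ℕ → ℝ := fun i =>
    (Representation.codimFixed τ ((𝔓E.ramificationSubgroup (E ≃ₐ[K] E) i).comap j) : ℝ) with hc
  -- Step 1: eventual vanishing of `c`
  have hcN : ∀ i, N < i → c i = 0 := by
    intro i hi
    simp only [hc, Nat.cast_eq_zero, Representation.codimFixed]
    have htop : Representation.fixedSubmodule τ
        ((𝔓E.ramificationSubgroup (E ≃ₐ[K] E) i).comap j) = ⊤ := by
      rw [eq_top_iff]
      intro x _
      rw [Representation.mem_fixedSubmodule]
      intro σ hσ
      rw [hN i hi.le, Subgroup.mem_comap, Subgroup.mem_bot] at hσ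
      change ρ (σ : absoluteGaloisGroup K) x = x
      rw [hE σ σ.2 hσ, Module.End.one_apply]
    rw [htop]
    haveI : Subsingleton (M ⧸ (⊤ : Submodule A M)) := Submodule.Quotient.subsingleton_iff.mpr rfl
    exact finrank_zero_of_subsingleton
  -- Step 2: the Swan conductor
  have hswan : ρ.swanConductorAt (𝓞 K) 𝔓 =
      ∑ i ∈ Finset.range N, ((Nat.card (𝔓E.ramificationSubgroup (E ≃ₐ[K] E) (i + 1)) : ℝ) /
        Nat.card (𝔓E.ramificationSubgroup (E ≃ₐ[K] E) 0)) * c (i + 1) := by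
    rw [swanConductorAt_def, ← integral_Ioi_comp_ceil_herbrandPsi 𝔓E (E ≃ₐ[K] E) c hcN]
    refine setIntegral_congr_fun measurableSet_Ioi fun u _ => ?_
    simp only [hc]
    rw [ContinuousRep.codimFixed, Representation.codimFixed,
      fixedSubmodule_absUpperRamificationSubgroup_eq hH h𝔓 E ρ hE u]
    rfl
  -- Step 3: the tame term
  have htame : (ρ.codimFixed I : ℝ) = c 0 := by
    simp only [hc]
    rw [Ideal.ramificationSubgroup_zero, comap_inertia_comp_subtype_eq_top, ContinuousRep.codimFixed,
      Representation.codimFixed]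
    have hfix : ρ.fixedSubmodule I = Representation.fixedSubmodule τ ⊤ := by
      ext x
      rw [ContinuousRep.mem_fixedSubmodule, Representation.mem_fixedSubmodule]
      exact ⟨fun hx σ _ => hx σ σ.2, fun hx σ hσ => hx ⟨σ, hσ⟩ (Subgroup.mem_top _)⟩
    rw [hfix]
  -- Step 4: assemble
  rw [artinConductorAt_def, hswan, htame, artinExponent_def]
  have hsupp : (Function.support fun i : ℕ =>
      ((Nat.card (𝔓E.ramificationSubgroup (E ≃ₐ[K] E) i) : ℝ) /
        Nat.card (𝔓E.ramificationSubgroup (E ≃ₐ[K] E) 0)) * c i) ⊆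
      ((Finset.range (N + 1) : Finset ℕ) : Set ℕ) := by
    intro i hi
    rw [Finset.coe_range, Set.mem_Iio]
    by_contra h
    refine hi ?_
    change _ * c i = 0
    rw [hcN i (by omega), mul_zero]
  rw [finsum_eq_sum_of_support_subset _ hsupp, Finset.sum_range_succ', div_self
    (Nat.cast_ne_zero.mpr Nat.card_pos.ne'), one_mul, add_comm]

/-- **The parent file's lower-numbering formula from Herbrand's theorem for `K̄/E/K`**:
`artinConductorAt_eq_finsum_ramificationSubgroup` (`ArtinConductor.lean`) follows from the named
fact `absUpperRamificationSubgroup_map_absRestrictNormalHom` (hypothesis `hH`), by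
`artinConductorAt_eq_artinExponent_inertia_of` and
`artinConductorAt_eq_finsum_ramificationSubgroup_of` (`ArtinConductorIntegrality.lean`).
Ref: Serre, *Local Fields*, Ch. VI §2, Cor. 1' to Prop. 2; Ch. IV §3, Prop. 14.
[cite: SerreLocalFields1979, Ch. VI §2, Cor. 1'] -/
theorem artinConductorAt_eq_finsum_ramificationSubgroup_of_herbrand
    (hH : absUpperRamificationSubgroup_map_absRestrictNormalHom (K := K)) :
    artinConductorAt_eq_finsum_ramificationSubgroup (K := K) (A := A) (M := M) :=
  artinConductorAt_eq_finsum_ramificationSubgroup_of (artinConductorAt_eq_artinExponent_inertia_of hH)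

/-- **Artin–Katz integrality (finite-quotient form) from Herbrand's theorem and Artin's theorem for
the inertia group.**  The corrected integrality statement
`exists_natCast_eq_artinConductorAt_of_hasOpenInertiaKerAt` of `ArtinConductor.lean` follows from
the two named facts `absUpperRamificationSubgroup_map_absRestrictNormalHom` (`hH`, Serre IV §3) and
`exists_natCast_eq_artinExponent` (`hint`, Serre VI §2 Thm 1'), by
`artinConductorAt_eq_artinExponent_inertia_of` and
`exists_natCast_eq_artinConductorAt_of_hasOpenInertiaKerAt_of_artinExponent`
(`ArtinConductorIntegrality.lean`).  This is Katz's proof of Prop. 1.9 in the finite-quotient case.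
Ref: Katz (1988), Ch. 1, proof of Prop. 1.9; Serre, *Local Fields*, Ch. VI §2 Thm 1' and Cor. 1'.
[cite: Katz1988, Ch. 1, Prop. 1.9 (proof)] -/
theorem exists_natCast_eq_artinConductorAt_of_hasOpenInertiaKerAt_of_herbrand
    (hH : absUpperRamificationSubgroup_map_absRestrictNormalHom (K := K))
    (hint : exists_natCast_eq_artinExponent (K := K) (A := A) (M := M)) :
    exists_natCast_eq_artinConductorAt_of_hasOpenInertiaKerAt.{u, v, w} (K := K) (A := A) (M := M) :=
  exists_natCast_eq_artinConductorAt_of_hasOpenInertiaKerAt_of_artinExponent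
    (artinConductorAt_eq_artinExponent_inertia_of hH) hint

end Glue

end GaloisRep

/-! ### Herbrand's theorem for `K̄/E/K` at a prime of a number field; the final reductions -/

section HerbrandQuotient

variable {K : Type u} [Field K] {A : Type v} [Field A] [TopologicalSpace A]
  {M : Type w} [AddCommGroup M] [Module A M] [TopologicalSpace M]

/-- **Discharge of `Literature.NumberTheory.GaloisRepresentations.absUpperRamificationSubgroup_map_absRestrictNormalHom` modulo Herbrand's
theorem at the finite layers.**  `Γ_K^u|_E = Gal(E/K)^u` at every prime `𝔓 ∣ v` of a number field
follows from the parent file's named fact `herbrand_quotient` for all layers `E ≤ E'` of `K̄`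
(hypothesis `hq`, quantified over the coefficient ring `R` so that the statement is the one a
discharge `herbrand_quotient_holds` provides), by
`absUpperRamificationSubgroup_map_eq_of_herbrand_quotient` (`RamificationFiltrationTowerProofs`:
transport of structure and compactness of `Γ_K`): `𝔓` is maximal and its residue field over
`𝓞 K` is the finite field `𝓞 K / v`.
Ref: Serre, *Local Fields*, Ch. IV §3, Prop. 14 and Remark 1.
[cite: SerreLocalFields1979, Ch. IV §3 Prop. 14 and Remark 1] -/
theorem absUpperRamificationSubgroup_map_absRestrictNormalHom_of
    (hq : ∀ (R : Type u) [CommRing R] [Algebra R K] {E E' : IntermediateField K (AlgebraicClosure K)}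
      (hle : E ≤ E'), herbrand_quotient R (IntermediateField.restrict hle)) :
    absUpperRamificationSubgroup_map_absRestrictNormalHom (K := K) := by
  intro _ v 𝔓 h𝔓 E _ _ u
  haveI : 𝔓.IsMaximal := HeightOneSpectrum.isMaximal_of_mem_primesAbove h𝔓
  haveI : Finite (𝓞 K ⧸ 𝔓.under (𝓞 K)) := by
    rw [← h𝔓.2.over]
    exact Ideal.finiteQuotientOfFreeOfNeBot v.asIdeal v.ne_bot
  exact absUpperRamificationSubgroup_map_eq_of_herbrand_quotient (𝓞 K) (fun hle => hq (𝓞 K) hle)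
    𝔓 E u

namespace GaloisRep

/-- **`a_𝔓(ρ) = f(ρ|_{I_𝔓})` from Herbrand's theorem at the finite layers**:
`artinConductorAt_eq_artinExponent_inertia` follows from `herbrand_quotient` for all layers of `K̄`
(`absUpperRamificationSubgroup_map_absRestrictNormalHom_of` and
`artinConductorAt_eq_artinExponent_inertia_of`).
[cite: Katz1988, Ch. 1, Prop. 1.9 (proof)] [cite: SerreLocalFields1979, Ch. IV §3 Prop. 14] -/
theorem artinConductorAt_eq_artinExponent_inertia_of_herbrand_quotient
    (hq : ∀ (R : Type u) [CommRing R] [Algebra R K] {E E' : IntermediateField K (AlgebraicClosure K)}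
      (hle : E ≤ E'), herbrand_quotient R (IntermediateField.restrict hle)) :
    artinConductorAt_eq_artinExponent_inertia (K := K) (A := A) (M := M) :=
  artinConductorAt_eq_artinExponent_inertia_of (absUpperRamificationSubgroup_map_absRestrictNormalHom_of hq)

/-- **The parent file's lower-numbering formula from Herbrand's theorem at the finite layers**:
`artinConductorAt_eq_finsum_ramificationSubgroup` (`ArtinConductor.lean`) follows from
`herbrand_quotient` for all layers of `K̄`.
[cite: SerreLocalFields1979, Ch. VI §2, Cor. 1'] -/
theorem artinConductorAt_eq_finsum_ramificationSubgroup_of_herbrand_quotient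
    (hq : ∀ (R : Type u) [CommRing R] [Algebra R K] {E E' : IntermediateField K (AlgebraicClosure K)}
      (hle : E ≤ E'), herbrand_quotient R (IntermediateField.restrict hle)) :
    artinConductorAt_eq_finsum_ramificationSubgroup (K := K) (A := A) (M := M) :=
  artinConductorAt_eq_finsum_ramificationSubgroup_of_herbrand
    (absUpperRamificationSubgroup_map_absRestrictNormalHom_of hq)

/-- **Artin–Katz integrality, finite-quotient form, from Herbrand's theorem (finite level) and
Artin's theorem for the inertia group.**  The corrected integrality statement
`exists_natCast_eq_artinConductorAt_of_hasOpenInertiaKerAt` of `ArtinConductor.lean` — the faithful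
form of the mis-stated `exists_natCast_eq_artinConductorAt` [Katz1988, Prop. 1.9] — follows from
exactly two named facts of the printed theory: Herbrand's theorem `(G/H)^v = G^v H/H` for finite
Galois extensions (`herbrand_quotient`, Serre IV §3 Prop. 14; hypothesis `hq`) and Artin's theorem
`f(χ) ∈ ℕ` for representations of the inertia group (`exists_natCast_eq_artinExponent`, Serre VI §2
Thm 1'; hypothesis `hint`).  Everything else in Katz's proof of Prop. 1.9 for the finite-quotient
case (inflation on inertia, surjectivity of inertia, the upper numbering of `K̄/K`, the
change of variables between `∫₀^∞ codim M^{Γ_K^u} du` and `Σ (g_i/g_0) codim M^{G_i}`) is proved in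
this file and its imports.
[cite: Katz1988, Ch. 1, Prop. 1.9 (proof)] [cite: SerreLocalFields1979, Ch. VI §2 Thm 1'] -/
theorem exists_natCast_eq_artinConductorAt_of_hasOpenInertiaKerAt_of_herbrand_quotient
    (hq : ∀ (R : Type u) [CommRing R] [Algebra R K] {E E' : IntermediateField K (AlgebraicClosure K)}
      (hle : E ≤ E'), herbrand_quotient R (IntermediateField.restrict hle))
    (hint : exists_natCast_eq_artinExponent (K := K) (A := A) (M := M)) :
    exists_natCast_eq_artinConductorAt_of_hasOpenInertiaKerAt.{u, v, w} (K := K) (A := A) (M := M) :=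
  exists_natCast_eq_artinConductorAt_of_hasOpenInertiaKerAt_of_herbrand
    (absUpperRamificationSubgroup_map_absRestrictNormalHom_of hq) hint

end GaloisRep

end HerbrandQuotient

end Literature.NumberTheory.GaloisRepresentations
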